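import Mathlib

/-!
# Frame cap: a complementary-frame ladder has at most `C(2l, l)` classes (support file)

Item `stmt-MatrixMultiplication-14308` (`FourierTwoFamiliesModP.PrimeTwoFamilies`, CKSU 2005
Conj. 4.7 with prime cyclic hosts), line Sketch, stub `frameCap` (the line's ZONE THEOREM).

Line Sketch reduces the conjecture to ORDERED ESCAPE LADDERS.  A ladder whose directness and
one-directional separation have LINEAR certificates consists of `r` pairs of `l`-dimensional
subspaces `V c, W c ≤ F^{2l}` with

* (diagonal) `V c ⊓ W c = ⊥`, i.e. `V c ⊕ W c = F^{2l}`;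
* (cross, one direction only) `V p ⊔ W q ≠ ⊤` for `p < q`.

`frameCap`: such a ladder has at most `Nat.choose (2 * l) l` classes (the bound is attained by the
coordinate frames of CKSU Prop. 4.5).  This is Lovász's (1977) skew version of the Bollobás
two-families theorem for subspaces, in the special case `dim V + dim W = dim (ambient)`.

## Proof (exterior algebra)

For each class `c` choose a basis family `v c : Fin l → E` of `V c` and a linear surjection
`π c : E → F^l` with kernel `W c` (coordinates of a basis of `E ⧸ W c`).  Put
`x p := v p 0 ∧ ⋯ ∧ v p (l-1) ∈ ⋀^l E` and `T q := ⋀^l (π q) : ⋀^l E → ⋀^l F^l`, so that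
`T q (x p) = ⋀ (π q ∘ v p)`.

* `p = q`: `V c ⊓ ker (π c) = ⊥`, so `π c ∘ v c` is linearly independent and its top wedge is
  nonzero (`exteriorPower.ιMulti_family_linearIndependent_field`).
* `p < q`: if `π q ∘ v p` were independent, these `l` vectors would span `F^l`, forcing
  `V p + ker (π q) = E`, i.e. `V p ⊔ W q = ⊤`; so the family is dependent and its wedge vanishes
  (`AlternatingMap.map_linearDependent`).

The matrix `(T q (x p))_{p,q}` is triangular with nonzero diagonal, so the `x p` are linearly
independent in `⋀^l E`, whose dimension is `Nat.choose (2 * l) l` (`exteriorPower.finrank_eq`).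
-/

-- single-conjunct summit: the mandated namespace repeats `MatrixMultiplication` (summit = sub-problem).
set_option linter.dupNamespace false

namespace Summit.MatrixMultiplication.MatrixMultiplication.Theorems.PrimeTwoFamilies.LadderLift

/-- Triangularity forces independence: if linear maps `T q` satisfy `T c (x c) ≠ 0` and
`T q (x p) = 0` for `p < q`, then the family `x` is linearly independent. -/
private lemma linearIndependent_of_triangular {F U U' : Type*} [Field F] [AddCommGroup U]
    [Module F U] [AddCommGroup U'] [Module F U'] {r : ℕ} (x : Fin r → U)
    (T : Fin r → U →ₗ[F] U') (hdiag : ∀ c, T c (x c) ≠ 0)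
    (hlow : ∀ p q, p < q → T q (x p) = 0) : LinearIndependent F x := by
  classical
  rw [Fintype.linearIndependent_iff]
  intro g hg
  by_contra! hne
  obtain ⟨i₀, hi₀⟩ := hne
  obtain ⟨q, hq, hmax⟩ := Finset.exists_max_image (Finset.univ.filter fun p => g p ≠ 0)
    (fun p => p) ⟨i₀, by simpa using hi₀⟩
  simp only [Finset.mem_filter, Finset.mem_univ, true_and] at hq hmax
  have hsum : ∑ p, T q (g p • x p) = T q (g q • x q) := by
    refine Finset.sum_eq_single q (fun p _ hpq => ?_) (by simp)
    rcases lt_or_gt_of_ne hpq with hlt | hgt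
    · rw [map_smul, hlow p q hlt, smul_zero]
    · have hp : g p = 0 := not_not.1 fun hp => (not_le.2 hgt) (hmax p hp)
      rw [hp, zero_smul, map_zero]
  have h := congrArg (T q) hg
  rw [map_sum, map_zero, hsum, map_smul, smul_eq_zero] at h
  exact h.elim hq (hdiag q)

/-- Over a field, the wedge `u 0 ∧ ⋯ ∧ u (n-1)` of a linearly independent family is nonzero
(a member of the independent family `exteriorPower.ιMulti_family_linearIndependent_field`). -/
private lemma ιMulti_ne_zero_of_linearIndependent {F U : Type*} [Field F] [AddCommGroup U]
    [Module F U] {n : ℕ} {u : Fin n → U} (hu : LinearIndependent F u) :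
    exteriorPower.ιMulti F n u ≠ 0 := by
  have hli := exteriorPower.ιMulti_family_linearIndependent_field (n := n) hu
  have hs := hli.ne_zero
    (Set.powersetCard.ofFinEmbEquiv (OrderIso.refl (Fin n)).toOrderEmbedding)
  rw [exteriorPower.ιMulti_family, Equiv.symm_apply_apply] at hs
  exact hs

/-- The zone theorem in a coordinate-free form: in a `2l`-dimensional space `E`, a family of
`l`-dimensional pairs `(V c, W c)` with `V c ⊓ W c = ⊥` and `V p ⊔ W q ≠ ⊤` for `p < q` has at
most `Nat.choose (2 * l) l` members. -/
private theorem frameCap_of_finrank_eq {F : Type*} [Field F] {E : Type*} [AddCommGroup E]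
    [Module F E] [FiniteDimensional F E] {l r : ℕ} (hE : Module.finrank F E = 2 * l)
    (V W : Fin r → Submodule F E)
    (hdimV : ∀ c, Module.finrank F (V c) = l) (hdimW : ∀ c, Module.finrank F (W c) = l)
    (hdiag : ∀ c, V c ⊓ W c = ⊥) (hcross : ∀ p q : Fin r, p < q → V p ⊔ W q ≠ ⊤) :
    r ≤ (2 * l).choose l := by
  -- (0) basis families `v c : Fin l → E` of the `V c`
  have hbasis : ∀ c, ∃ v : Fin l → E,
      LinearIndependent F v ∧ Submodule.span F (Set.range v) = V c := fun c => by
    let b := Module.finBasisOfFinrankEq F (V c) (hdimV c)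
    refine ⟨(V c).subtype ∘ ⇑b, b.linearIndependent.map' _ (Submodule.ker_subtype _), ?_⟩
    rw [Set.range_comp, Submodule.span_image, b.span_eq, Submodule.map_top,
      Submodule.range_subtype]
  choose v hvli hvspan using hbasis
  -- (1) projections `π c : E → F^l` with kernel exactly `W c`
  have hproj : ∀ c, ∃ π : E →ₗ[F] (Fin l → F), LinearMap.ker π = W c := fun c => by
    have hq : Module.finrank F (E ⧸ W c) = l := by
      have h := (W c).finrank_quotient_add_finrank
      rw [hdimW c, hE] at h
      omega
    exact ⟨(Module.finBasisOfFinrankEq F (E ⧸ W c) hq).equivFun.toLinearMap ∘ₗ (W c).mkQ, by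
      rw [LinearEquiv.ker_comp, Submodule.ker_mkQ]⟩
  choose π hker using hproj
  -- (2) diagonal pairs: `π c ∘ v c` is linearly independent
  have hdiag' : ∀ c, LinearIndependent F (π c ∘ v c) := fun c =>
    (hvli c).map (by rw [hvspan, hker]; exact disjoint_iff.2 (hdiag c))
  -- (3) lower cross pairs: `π q ∘ v p` is linearly dependent
  have hcross' : ∀ p q, p < q → ¬LinearIndependent F (π q ∘ v p) := fun p q hpq hli => by
    have h1 := hli.span_eq_top_of_card_eq_finrank'
      (by rw [Fintype.card_fin, Module.finrank_fin_fun])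
    rw [Set.range_comp, Submodule.span_image, hvspan] at h1
    have h2 := congrArg (Submodule.comap (π q)) h1
    rw [Submodule.comap_map_eq, Submodule.comap_top, hker] at h2
    exact hcross p q hpq h2
  -- (4) the wedges `x p := ⋀ (v p)` are independent in `⋀^l E`, tested by `T q := ⋀^l (π q)`
  have hx : LinearIndependent F (fun p => exteriorPower.ιMulti F l (v p)) :=
    linearIndependent_of_triangular _ (fun q => exteriorPower.map l (π q))
      (fun c => by
        rw [exteriorPower.map_apply_ιMulti]
        exact ιMulti_ne_zero_of_linearIndependent (hdiag' c))
      (fun p q hpq => by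
        rw [exteriorPower.map_apply_ιMulti]
        exact AlternatingMap.map_linearDependent _ _ (hcross' p q hpq))
  have h := hx.fintype_card_le_finrank
  rw [Fintype.card_fin, exteriorPower.finrank_eq, hE] at h
  exact h

/-- ZONE THEOREM (Lovász 1977, skew Bollobás for subspaces; the case `dim = l + l = 2l`): a ladder
of `l`-dimensional pairs `(V c, W c)` in `F^{2l}` that is complementary on the diagonal
(`V c ⊓ W c = ⊥`) and non-spanning on lower cross pairs (`V p ⊔ W q ≠ ⊤` for `p < q`) has at
most `Nat.choose (2 * l) l` classes. -/
theorem frameCap {F : Type*} [Field F] {l r : ℕ}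
    (V W : Fin r → Submodule F (Fin (2 * l) → F))
    (hdimV : ∀ c, Module.finrank F (V c) = l) (hdimW : ∀ c, Module.finrank F (W c) = l)
    (hdiag : ∀ c, V c ⊓ W c = ⊥)
    (hcross : ∀ p q : Fin r, p < q → V p ⊔ W q ≠ ⊤) :
    r ≤ (2 * l).choose l :=
  frameCap_of_finrank_eq (Module.finrank_fin_fun F) V W hdimV hdimW hdiag hcross

end Summit.MatrixMultiplication.MatrixMultiplication.Theorems.PrimeTwoFamilies.LadderLift
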